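import Mathlib
import Literature.NumberTheory.Automorphic.BaseChangeStrongAllFinite
import Literature.NumberTheory.GaloisRepresentations.ArtinFormalismInductionProofs
import Literature.NumberTheory.Automorphic.BaseChangeRamifiedPlacePackage
import Summits.Langlands.Langlands.Theorems.SkinnerWilesDefectOneStrongLiftingAllFinite
import Summits.Langlands.Langlands.Theorems.SkinnerWilesDefectOneStrongLiftingAllFiniteGlobalQuotient

/-!
# The ramified clause of `StrongLiftingAllFinite` from the twisted standard-`L` package of a weak
# base-change pair (Jacquet–Langlands' method for `GL_n`), and the item from named leaves
# (item stmt-Langlands-15194, route `SkinnerWilesDefectOne`)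

The residue of the item `StrongLiftingAllFinite` (= `ArthurClozel1989_strongLifting_allFinite`,
Arthur–Clozel 1989, Ch. 3, Thm. 5.1 at ALL finite places) is (`…StrongLiftingAllFinite`,
`strongLiftingAllFinite_iff_unramifiedLift_and_ramified`) the conjunction of (U) — its clause at
the places unramified in `E/F`, already reduced in the tree to five named leaves
(`ArthurClozel1989_strongLifting_unramified_of_offS`) — and the RAMIFIED CLAUSE (R).  Arthur–Clozel
prove (R) (pp. 212–214) with the full twisted trace identity at the ramified place and the local
lifting of Ch. 1 §6, none of which the tree has.  THIS FILE proves (R) instead by the method with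
which the tree proves Gelbart's Prop. 4.1 for `GL₂` (`StrongArtinGL2*`: Jacquet–Langlands 1970,
proof of Thm. 12.2, pp. 209–211): the quotient of the functional equations of the twisted standard
`L`-functions `∏_{i mod ℓ} Λ(s, ω ⊗ π ⊗ ηⁱ)` and `Λ(s, (ω ∘ N_{E/F}) ⊗ P)`, for an idèle class
character `ω` of `F` trivial at the ramified place `v₀` and highly ramified at the other
exceptional places, isolates the local factors at `v₀` / `w₀`; their zeros on the vertical
progressions `1 - z q^{-s} = 0` are rigid (`…EulerZeros`, `…GlobalQuotient`: PROVED), and the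
Jacquet–Piatetski-Shapiro–Shalika shape of the local factors of the generic `P_{w₀}` and of its
contragredient then forces `P_{w₀}` to be the unramified principal series with `t_{P,w₀} = t_{π,v₀}`.

* the hypothesis `H` (section `Package`) — VERBATIM the named fact
  `Literature.NumberTheory.Automorphic.JPSS1983_twistedStandardLPackage_weakBaseChange`
  (`BaseChangeRamifiedPlacePackage`, accepted p110467; the `GL_n` base-change analogue of the
  tree's `JacquetLanglands1970_twistedCuspidalPackage`), displayed inline: for a weak base-change
  pair `(π, P)` of cuspidal data in prime degree, a place `w₀ ∣ v₀` with `v₀` ramified in `E` and `π`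
  unramified at `v₀` with Satake parameter `α`: `α` is generic, and there are the Euler data
  `(u_i, m_i)_{i < r}` of `P_{w₀}` with their Satake dictionary, and meromorphic
  `Λ_π, Λ_P, Λ_π', Λ_P'`, archimedean data, `ε`-factors, Euler agreements off `v₀, ∞`, functional
  equations and a non-vanishing.
* `ramifiedClause_of_package` — **(R) from the package** (PROVED here:
  `ramifiedClause_of_meromorphic_functional_equations` + the dictionary clause + `card α = n`).
* `strongLiftingAllFinite_of_strongLifting_unramified_of_package`,
  `strongLiftingAllFinite_of_offS_of_package`, `strongLiftingAllFinite_item_of_offS_of_package`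
  (and the `…_of_namedPackage` forms taking the named fact itself) —
  **the item from NAMED LEAVES ONLY**: `{ArthurClozel1989_weakLifting_cuspidal_offS,
  ArthurClozel1989_cuspidal_descent_offS, multiplicity_one_gl, JacquetShalika1981 (2.2), (2.3)}`
  (for (U)) and the package `H` (for (R)).  So the residue of stmt-Langlands-15194 is made of
  named facts of the tree, none of which is the twisted trace formula at a ramified place.

## References

* H. Jacquet, I. I. Piatetski-Shapiro, J. A. Shalika, *Rankin–Selberg convolutions*, Amer. J.
  Math. 105 (1983), §§8–9 (local factors of generic representations; (9.4)–(9.5)). [JPSS1983]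
* R. Godement, H. Jacquet, *Zeta functions of simple algebras*, LNM 260 (1972), Thm. 13.8, §8.
  [GodementJacquet1972]
* H. Jacquet, *Principal `L`-functions of the linear group*, Corvallis (1979), Part 2, (1.3)–(1.4),
  Thm. (6.2). [JacquetCorvallis1979]
* J. A. Shalika, *The multiplicity one theorem for `GL_n`*, Ann. of Math. 100 (1974), Thm. 5.5.
  [Shalika1974]
* I. N. Bernstein, A. V. Zelevinsky, *Induced representations of reductive `p`-adic groups I*,
  Ann. Sci. ÉNS 10 (1977), Thm. 4.2; A. V. Zelevinsky, II, Ann. Sci. ÉNS 13 (1980), Thm. 9.7.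
  [BernsteinZelevinsky1977] [Zelevinsky1980]
* H. Jacquet, R. P. Langlands, *Automorphic Forms on GL(2)*, LNM 114 (1970), Lemma 12.5 and
  proof of Thm. 12.2, pp. 209–211. [JacquetLanglands1970]
* H. Jacquet, J. A. Shalika, Amer. J. Math. 103 (1981), Thm. 5.3, §1. [JacquetShalikaAJM1981]
* J. Arthur, L. Clozel, Ann. of Math. Stud. 120 (1989), Ch. 3: §1 (1.1), proof of Thm. 3.1
  (p. 172), Lemma 4.3, Thm. 5.1. [ArthurClozelAMS120]
-/

set_option linter.dupNamespace false -- project-wide option (lakefile weak.linter.dupNamespace); `Summit.Langlands.Langlands` is the mandated namespace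

noncomputable section

open scoped NumberField
open Polynomial Finset Complex Filter Topology Set NumberField IsDedekindDomain MeasureTheory
open Literature.NumberTheory.LFunctions Literature.NumberTheory.Automorphic

namespace Summit.Langlands.Langlands.Theorems.SkinnerWilesDefectOne.StrongLiftingAllFinite

/-! ### The package, as a hypothesis

The hypothesis `H` of this section is VERBATIM the named fact
`Literature.NumberTheory.Automorphic.JPSS1983_twistedStandardLPackage_weakBaseChange`
(`Literature/NumberTheory/Automorphic/BaseChangeRamifiedPlacePackage.lean`, accepted p110467; the
`GL_n` base-change analogue of the accepted `JacquetLanglands1970_twistedCuspidalPackage`): for a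
weak base-change pair `(π, P)` of cuspidal data in prime degree, a place `w ∣ v` with `v` ramified
in `E` and `π` unramified at `v` with Satake parameter `α` — `α` is generic (`b ≠ q a`), and there
are the JPSS Euler data `(u_i, m_i)_{i<r}` of the generic `P_w` (`L(s,P_w)⁻¹ = ∏(1 - u_i q^{-s})`,
`L(s,P̃_w)⁻¹ = ∏(1 - u_i⁻¹ q^{-(m_i-1)} q^{-s})`) with their Satake dictionary (all `m_i = 1` and
`r = n` ⇒ `P` has Satake parameter `{u_i}` at `w`), meromorphic `Λ_π, Λ_P, Λ_π', Λ_P'` (the twisted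
completed standard `L`-functions `∏_i Λ(s, ω ⊗ π ⊗ ηⁱ)`, `Λ(s, (ω ∘ N) ⊗ P)` and contragredient
partners, `ω_{v} = 1`, `ω` killing the other exceptional places), `ε`-factors, archimedean data,
the two cross-multiplied Euler agreements for `re s > c`, the two functional equations and a
non-vanishing.  It is displayed inline (this proof file carries no definition, D-0026); the last
section assembles the same theorems from the named fact itself. -/

section Package

variable (H : ∀ (n : ℕ) (F E : Type) [Field F] [NumberField F] [Field E] [NumberField E] [Algebra F E]
    [IsGalois F E], (Module.finrank F E).Prime →
    ∀ (hF : isCompact_glFiniteIntegralLevel n F) (hE : isCompact_glFiniteIntegralLevel n E)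
      (π : CuspidalAutomorphicRepData n F hF) (P : CuspidalAutomorphicRepData n E hE),
      IsWeakBaseChangeLiftAE π.1 P.1 →
      ∀ (w : HeightOneSpectrum (𝓞 E)) (v : HeightOneSpectrum (𝓞 F)) (α : Multiset ℂ),
        w.asIdeal.under (𝓞 F) = v.asIdeal → ¬ Algebra.IsUnramifiedIn (𝓞 E) v.asIdeal →
        π.1.HasSatakeParamAt v α →
        (∀ a ∈ α, ∀ b ∈ α, b ≠ (v.residueCard : ℂ) * a) ∧
        ∃ (r : ℕ) (u : Fin r → ℂ) (m : Fin r → ℕ) (Λπ ΛP Λπ' ΛP' επ εP : ℂ → ℂ)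
          (μπ μP μπ' μP' : Multiset ℂ) (c : ℝ),
          (∀ i, u i ≠ 0) ∧ (∀ i, 1 ≤ m i) ∧
          ((∀ i, m i = 1) → r = n → P.1.HasSatakeParamAt w (∑ i, ({u i} : Multiset ℂ))) ∧
          Meromorphic Λπ ∧ Meromorphic ΛP ∧ Meromorphic Λπ' ∧ Meromorphic ΛP' ∧
          Continuous επ ∧ Continuous εP ∧ (∀ s, εP s ≠ 0) ∧
          (∀ s : ℂ, c < s.re →
            Λπ s * ((α.map fun a => eulerTerm v.residueCard a s).prod *
                (μπ.map fun x => (Gammaℝ (s + x))⁻¹).prod) =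
              ΛP s * ((∏ i, eulerTerm w.residueCard (u i) s) *
                (μP.map fun x => (Gammaℝ (s + x))⁻¹).prod)) ∧
          (∀ s : ℂ, c < s.re →
            Λπ' s * ((α.map fun a => eulerTerm v.residueCard a⁻¹ s).prod *
                (μπ'.map fun x => (Gammaℝ (s + x))⁻¹).prod) =
              ΛP' s * ((∏ i, eulerTerm w.residueCard
                  ((u i)⁻¹ * ((w.residueCard : ℂ)⁻¹) ^ (m i - 1)) s) *
                (μP'.map fun x => (Gammaℝ (s + x))⁻¹).prod)) ∧
          (∀ s, Λπ s = επ s * Λπ' (1 - s)) ∧ (∀ s, ΛP s = εP s * ΛP' (1 - s)) ∧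
          (∃ s, AnalyticAt ℂ Λπ' s ∧ Λπ' s ≠ 0))

include H

/-! ### (R) from the package -/

/-- **The ramified clause (R) from the package** (Jacquet–Langlands' method, `GL_n`): at a place
`w ∣ v` with `v` ramified in `E/F` and `π` unramified at `v` with Satake parameter `α`, the
cuspidal weak lift `P` has Satake parameter `α` at `w`.  Proof: the package at `(w, v, α)`;
`0 ∉ α` (`hasSatakeParamAt_ne_zero_holds`, Cartier); `ramifiedClause_of_meromorphic_functional_equations`
gives every `m_i = 1` and `α = {u_i}`; `card α = n` gives `r = n`; the Satake dictionary of the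
package concludes. [cite: JacquetLanglands1970, proof of Thm. 12.2, pp. 209–211]
[cite: ArthurClozelAMS120, Ch. 3 Thm. 5.1] -/
theorem ramifiedClause_of_package :
    ∀ (n : ℕ) (F E : Type) [Field F] [NumberField F] [Field E] [NumberField E] [Algebra F E]
      [IsGalois F E], (Module.finrank F E).Prime →
      ∀ (hF : isCompact_glFiniteIntegralLevel n F) (hE : isCompact_glFiniteIntegralLevel n E)
        (π : CuspidalAutomorphicRepData n F hF) (P : CuspidalAutomorphicRepData n E hE),
        IsWeakBaseChangeLiftAE π.1 P.1 →
          ∀ (w : HeightOneSpectrum (𝓞 E)) (v : HeightOneSpectrum (𝓞 F)) (α : Multiset ℂ),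
            w.asIdeal.under (𝓞 F) = v.asIdeal → ¬ Algebra.IsUnramifiedIn (𝓞 E) v.asIdeal →
              π.1.HasSatakeParamAt v α → P.1.HasSatakeParamAt w α := by
  intro n F E _ _ _ _ _ _ hl hF hE π P hBC w v α hwv hv hα
  obtain ⟨hgen, r, u, m, Λπ, ΛP, Λπ', ΛP', επ, εP, μπ, μP, μπ', μP', c, hu, hm, hdict, hΛπ, hΛP,
    hΛπ', hΛP', hεπ, hεP, hεP0, hEq, hEq', hFπ, hFP, hNV⟩ := H n F E hl hF hE π P hBC w v α hwv hv hα
  have h0 : (0 : ℂ) ∉ α := fun h => hasSatakeParamAt_ne_zero_holds hα 0 h rfl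
  -- `q_{w} = q_{v}` since `f(w|v) = 1` over the ramified `v`
  have hq : w.residueCard = v.residueCard := by
    rw [Literature.NumberTheory.GaloisRepresentations.residueCard_eq_pow_inertiaDeg_of_under_eq hwv,
      HeightOneSpectrum.inertiaDeg_eq_one_of_not_isUnramifiedIn hl hwv hv, pow_one]
  rw [hq] at hEq hEq'
  obtain ⟨hm1, hαu⟩ := ramifiedClause_of_meromorphic_functional_equations v.one_lt_residueCard h0
    hgen u m hu hm hΛπ hΛP hΛπ' hΛP' μπ μP μπ' μP' hεπ hεP hεP0 hEq hEq' hFπ hFP hNV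
  have hr : r = n := by
    have hc := hα.card_eq
    rw [hαu] at hc
    simpa using hc
  have h := hdict hm1 hr
  rwa [← hαu] at h

/-! ### The item from named leaves only -/

/-- **The all-finite-places strong lifting from the sibling fact at the unramified places and the
package**: (U) from `ArthurClozel1989_strongLifting_unramified`, (R) from
`ramifiedClause_of_package`, glued by `strongLiftingAllFinite_of_strongLifting_unramified_of_ramified`.
[cite: ArthurClozelAMS120, Ch. 3 Thm. 5.1] -/
theorem strongLiftingAllFinite_of_strongLifting_unramified_of_package
    (h : ArthurClozel1989_strongLifting_unramified) :
    ArthurClozel1989_strongLifting_allFinite :=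
  strongLiftingAllFinite_of_strongLifting_unramified_of_ramified h (ramifiedClause_of_package H)

/-- **The item from NAMED LEAVES of the tree only.**  Hypotheses `ha`, `hd`, `hm1`, `h22c`, `h23`
are the five leaves of `ArthurClozel1989_strongLifting_unramified_of_offS` (the `S`-threaded
Thm. 4.2 (a), (d), multiplicity one on `L²_cusp(GL_n)`, Jacquet–Shalika (2.2), (2.3)) giving (U);
`H` is the package giving (R).  No hypothesis is the twisted trace formula at a ramified place or
the local base change of Arthur–Clozel Ch. 1 §6.
[cite: ArthurClozelAMS120, Ch. 3 Thm. 4.2 (a), (d), Thm. 5.1] [cite: JacquetShalikaAJM1981, §2] -/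
theorem strongLiftingAllFinite_of_offS_of_package
    (ha : ∀ (n : ℕ) (F E : Type) [Field F] [NumberField F] [Field E] [NumberField E]
      [Algebra F E], ArthurClozel1989_weakLifting_cuspidal_offS n F E)
    (hd : ∀ (n : ℕ) (F E : Type) [Field F] [NumberField F] [Field E] [NumberField E]
      [Algebra F E], ArthurClozel1989_cuspidal_descent_offS n F E)
    (hm1 : ∀ (n : ℕ) (K : Type) [Field K] [NumberField K]
      (μ : Measure (AdelicGroupData.gl n K).automorphicQuotient)
      [(AdelicGroupData.gl n K).IsAutomorphicMeasure μ], multiplicity_one_gl n K μ)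
    (h22c : ∀ (n : ℕ) (K : Type) [Field K] [NumberField K]
      (μ : Measure (AdelicGroupData.gl n K).automorphicQuotient)
      [(AdelicGroupData.gl n K).IsAutomorphicMeasure μ],
      JacquetShalika1981_partialPairL_at_one_of_ne_conj (n := n) (K := K) (μ := μ))
    (h23 : ∀ (n : ℕ) (K : Type) [Field K] [NumberField K]
      (μ : Measure (AdelicGroupData.gl n K).automorphicQuotient)
      [(AdelicGroupData.gl n K).IsAutomorphicMeasure μ],
      JacquetShalika1981_partialPairL_pole_of_eq_conj (n := n) (K := K) (μ := μ)) :
    ArthurClozel1989_strongLifting_allFinite :=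
  strongLiftingAllFinite_of_offS_of_ramified ha hd hm1 h22c h23 (ramifiedClause_of_package H)

/-- **The item's literal signature from named leaves only** (the route statement
`StrongLiftingAllFinite` of stmt-Langlands-15194 with `IsWeakBaseChangeLiftAE` unfolded —
definitionally `ArthurClozel1989_strongLifting_allFinite`).  CONDITIONAL on the five leaves of (U)
and the package (R). [cite: ArthurClozelAMS120, Ch. 3 Thm. 5.1] -/
theorem strongLiftingAllFinite_item_of_offS_of_package
    (ha : ∀ (n : ℕ) (F E : Type) [Field F] [NumberField F] [Field E] [NumberField E]
      [Algebra F E], ArthurClozel1989_weakLifting_cuspidal_offS n F E)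
    (hd : ∀ (n : ℕ) (F E : Type) [Field F] [NumberField F] [Field E] [NumberField E]
      [Algebra F E], ArthurClozel1989_cuspidal_descent_offS n F E)
    (hm1 : ∀ (n : ℕ) (K : Type) [Field K] [NumberField K]
      (μ : Measure (AdelicGroupData.gl n K).automorphicQuotient)
      [(AdelicGroupData.gl n K).IsAutomorphicMeasure μ], multiplicity_one_gl n K μ)
    (h22c : ∀ (n : ℕ) (K : Type) [Field K] [NumberField K]
      (μ : Measure (AdelicGroupData.gl n K).automorphicQuotient)
      [(AdelicGroupData.gl n K).IsAutomorphicMeasure μ],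
      JacquetShalika1981_partialPairL_at_one_of_ne_conj (n := n) (K := K) (μ := μ))
    (h23 : ∀ (n : ℕ) (K : Type) [Field K] [NumberField K]
      (μ : Measure (AdelicGroupData.gl n K).automorphicQuotient)
      [(AdelicGroupData.gl n K).IsAutomorphicMeasure μ],
      JacquetShalika1981_partialPairL_pole_of_eq_conj (n := n) (K := K) (μ := μ)) :
    ∀ (n : ℕ) (F E : Type) [Field F] [NumberField F] [Field E] [NumberField E] [Algebra F E]
      [IsGalois F E], (Module.finrank F E).Prime →
      ∀ (hF : Literature.NumberTheory.Automorphic.isCompact_glFiniteIntegralLevel n F)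
        (hE : Literature.NumberTheory.Automorphic.isCompact_glFiniteIntegralLevel n E)
        (π : Literature.NumberTheory.Automorphic.CuspidalAutomorphicRepData n F hF)
        (P : Literature.NumberTheory.Automorphic.CuspidalAutomorphicRepData n E hE),
        (∀ᶠ w : IsDedekindDomain.HeightOneSpectrum (NumberField.RingOfIntegers E) in Filter.cofinite,
          ∀ (v : IsDedekindDomain.HeightOneSpectrum (NumberField.RingOfIntegers F)) (α : Multiset ℂ),
            w.asIdeal.under (NumberField.RingOfIntegers F) = v.asIdeal → π.1.HasSatakeParamAt v α →
              P.1.HasSatakeParamAt w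
                (α.map (· ^ w.asIdeal.inertiaDeg (NumberField.RingOfIntegers F)))) →
        ∀ (w : IsDedekindDomain.HeightOneSpectrum (NumberField.RingOfIntegers E))
          (v : IsDedekindDomain.HeightOneSpectrum (NumberField.RingOfIntegers F)) (α : Multiset ℂ),
          w.asIdeal.under (NumberField.RingOfIntegers F) = v.asIdeal → π.1.HasSatakeParamAt v α →
            P.1.HasSatakeParamAt w
              (α.map (· ^ w.asIdeal.inertiaDeg (NumberField.RingOfIntegers F))) :=
  strongLiftingAllFinite_of_offS_of_package H ha hd hm1 h22c h23

end Package

/-! ### From the NAMED package `JPSS1983_twistedStandardLPackage_weakBaseChange` -/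
/-- **The ramified clause (R) from the named package**: at a place `w ∣ v` with `v` ramified in
`E/F` and `π` unramified at `v` with Satake parameter `α`, the cuspidal weak lift `P` has Satake
parameter `α` at `w` — granted `JPSS1983_twistedStandardLPackage_weakBaseChange`.
[cite: JacquetLanglands1970, proof of Thm. 12.2, pp. 209–211] [cite: ArthurClozelAMS120, Ch. 3 Thm. 5.1] -/
theorem ramifiedClause_of_namedPackage (H : JPSS1983_twistedStandardLPackage_weakBaseChange) :
    ∀ (n : ℕ) (F E : Type) [Field F] [NumberField F] [Field E] [NumberField E] [Algebra F E]
      [IsGalois F E], (Module.finrank F E).Prime →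
      ∀ (hF : isCompact_glFiniteIntegralLevel n F) (hE : isCompact_glFiniteIntegralLevel n E)
        (π : CuspidalAutomorphicRepData n F hF) (P : CuspidalAutomorphicRepData n E hE),
        IsWeakBaseChangeLiftAE π.1 P.1 →
          ∀ (w : HeightOneSpectrum (𝓞 E)) (v : HeightOneSpectrum (𝓞 F)) (α : Multiset ℂ),
            w.asIdeal.under (𝓞 F) = v.asIdeal → ¬ Algebra.IsUnramifiedIn (𝓞 E) v.asIdeal →
              π.1.HasSatakeParamAt v α → P.1.HasSatakeParamAt w α :=
  ramifiedClause_of_package H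

/-- **`ArthurClozel1989_strongLifting_allFinite` from the sibling fact at the unramified places and
the named package.** [cite: ArthurClozelAMS120, Ch. 3 Thm. 5.1] -/
theorem strongLiftingAllFinite_of_strongLifting_unramified_of_namedPackage
    (h : ArthurClozel1989_strongLifting_unramified)
    (H : JPSS1983_twistedStandardLPackage_weakBaseChange) :
    ArthurClozel1989_strongLifting_allFinite :=
  strongLiftingAllFinite_of_strongLifting_unramified_of_package H h

/-- **`ArthurClozel1989_strongLifting_allFinite` (= item stmt-Langlands-15194) from NAMED LEAVES
ONLY**: the five leaves of `ArthurClozel1989_strongLifting_unramified_of_offS` and the named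
package.  This is the exact residue of the item in the tree.
[cite: ArthurClozelAMS120, Ch. 3 Thm. 4.2 (a), (d), Thm. 5.1] -/
theorem strongLiftingAllFinite_of_offS_of_namedPackage
    (ha : ∀ (n : ℕ) (F E : Type) [Field F] [NumberField F] [Field E] [NumberField E]
      [Algebra F E], ArthurClozel1989_weakLifting_cuspidal_offS n F E)
    (hd : ∀ (n : ℕ) (F E : Type) [Field F] [NumberField F] [Field E] [NumberField E]
      [Algebra F E], ArthurClozel1989_cuspidal_descent_offS n F E)
    (hm1 : ∀ (n : ℕ) (K : Type) [Field K] [NumberField K]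
      (μ : Measure (AdelicGroupData.gl n K).automorphicQuotient)
      [(AdelicGroupData.gl n K).IsAutomorphicMeasure μ], multiplicity_one_gl n K μ)
    (h22c : ∀ (n : ℕ) (K : Type) [Field K] [NumberField K]
      (μ : Measure (AdelicGroupData.gl n K).automorphicQuotient)
      [(AdelicGroupData.gl n K).IsAutomorphicMeasure μ],
      JacquetShalika1981_partialPairL_at_one_of_ne_conj (n := n) (K := K) (μ := μ))
    (h23 : ∀ (n : ℕ) (K : Type) [Field K] [NumberField K]
      (μ : Measure (AdelicGroupData.gl n K).automorphicQuotient)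
      [(AdelicGroupData.gl n K).IsAutomorphicMeasure μ],
      JacquetShalika1981_partialPairL_pole_of_eq_conj (n := n) (K := K) (μ := μ))
    (H : JPSS1983_twistedStandardLPackage_weakBaseChange) :
    ArthurClozel1989_strongLifting_allFinite :=
  strongLiftingAllFinite_of_offS_of_package H ha hd hm1 h22c h23

end Summit.Langlands.Langlands.Theorems.SkinnerWilesDefectOne.StrongLiftingAllFinite

end
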